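import Literature.NumberTheory.Automorphic.HarishChandraFinitenessGL
import Literature.NumberTheory.Automorphic.AutomorphicRepInfinitesimalCharacter
import Literature.NumberTheory.Automorphic.GLnCuspidalSpectrumSiegel
import HarnessLib

/-!
# Harish-Chandra finiteness at fixed level and fixed `K_∞`-slices for a clean cuspidal `π` —
crux HeckeEigenvalueField (stmt-Langlands-13632), line Sketch, stub FD-SLICE

Statement.  Let `π = W / ⊥` be a clean cuspidal automorphic representation datum of `GL_n(𝔸_K)`
(`CuspidalAutomorphicRepData n K hcpt` with `W' = ⊥`), `𝔫 ≠ 0` a level and `M` a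
finite-dimensional right-`K_∞`-stable space of functions on `K_∞`.  Then there is ONE
finite-dimensional space `T` of functions on `GL_n(𝔸_K)` containing every `K(𝔫)`-invariant
`φ ∈ W` all of whose right `K_∞`-slices `k ↦ φ (g k)` lie in `M`.

Proof.  By Schur's lemma for the irreducible `W / W'` (the tree's
`AutomorphicRepData.exists_hasInfinitesimalCharacter_gl`, Borel–Jacquet 1979, 4.6; Langlands 1979,
Prop. 2) the centre `Z(𝔤)` acts on `W / W'` through a character `θ`; since `W' = ⊥`, every
`φ ∈ W` is a `θ`-eigenfunction of every central word (`HasZCharacter`).  Every `φ ∈ W` is an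
automorphic form (`W ≤ 𝒜₀ ≤ 𝒜`, `isAutomorphicForm_of_mem_automorphicForms_gl`), `K(𝔫)` is an
admissible level (`principalCongruenceLevel_mem_finiteLevelsGL_holds`), so all such `φ` lie in the
span of the automorphic forms of level `K(𝔫)`, character `θ` and `K_∞`-slices in `M`, which is
finite-dimensional by Harish-Chandra's finiteness theorem, PROVED in the tree
(`harishChandra_finiteness_gl_holds`; Borel–Jacquet 1979, 4.3 (i); Harish-Chandra, LNM 62, Thm. 1).
-/

set_option linter.dupNamespace false -- project-wide: `Summit.Langlands.Langlands` is the mandated namespace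

noncomputable section

open scoped Classical
open NumberField IsDedekindDomain
open Literature.NumberTheory.Automorphic

namespace Summit.Langlands.Langlands.Theorems.HeckeEigenvalueField.Res

/-- **A clean datum with infinitesimal character `θ` consists of `θ`-eigenforms.**  If `π = W / W'`
on `GL_n(𝔸_K)` has `W' = ⊥` and infinitesimal character `θ` (for its Lie action on `W / W'`, unique
by `hasLieAction_unique`), then every central word `p` acts on every `φ ∈ W` by the scalar
`θ(p)`: `[p φ] = θ(p) [φ]` in `W / W' = W` (`envelopingAction_mkQ_eq_smul_iff`).
Borel–Jacquet 1979, §1.6 and 4.6. [cite: BorelJacquetCorvallis1979, 4.6] -/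
theorem hasZCharacter_of_hasInfinitesimalCharacter_of_bot {n : ℕ} {K : Type} [Field K] [NumberField K]
    {hcpt : isCompact_glFiniteIntegralLevel n K} (π : AutomorphicRepData (AutomorphyDatum.gl n K hcpt))
    (hbot : π.W' = ⊥) {θ : centerU (AutomorphyDatum.gl n K hcpt).arch →ₐ[ℝ] ℂ}
    (hθ : π.HasInfinitesimalCharacter θ) {φ : (AdelicGroupData.gl n K).Adelic → ℂ} (hφ : φ ∈ π.W) :
    HasZCharacter (AutomorphyDatum.gl n K hcpt).ofArch φ θ := by
  obtain ⟨ρ, hρ, hinf⟩ := hθ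
  have hρeq : ρ = π.lieRep := π.hasLieAction_unique hρ π.hasLieAction_lieRep
  subst hρeq
  intro p hp
  have h1 : envelopingAction π.lieRep (freeToEnveloping _ p) (π.mkQ ⟨φ, hφ⟩) =
      θ ⟨freeToEnveloping _ p, hp⟩ • π.mkQ ⟨φ, hφ⟩ := by
    have h : envelopingAction π.lieRep (freeToEnveloping _ p) =
        algebraMap ℂ (Module.End ℂ π.Quot) (θ ⟨freeToEnveloping _ p, hp⟩) :=
      hinf ⟨freeToEnveloping _ p, hp⟩
    rw [h, Module.algebraMap_end_apply]
  have h2 := (π.envelopingAction_mkQ_eq_smul_iff p _ ⟨φ, hφ⟩).1 h1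
  rw [hbot, Submodule.mem_bot, sub_eq_zero] at h2
  exact h2

/-- **Stub FD-SLICE — Harish-Chandra: at fixed level and fixed `K_∞`-types a clean cuspidal `π` is
finite-dimensional.**  For `π` cuspidal with `W' = ⊥` (so `Z(𝔤)` acts on the irreducible `W` by a
character, `AutomorphicRepData.exists_hasInfinitesimalCharacter_gl` and
`hasZCharacter_of_hasInfinitesimalCharacter_of_bot`), a level `𝔫 ≠ 0`
(`principalCongruenceLevel_mem_finiteLevelsGL_holds`) and a finite-dimensional right-`K_∞`-stable
space `M` of functions on `K_∞`, the `K(𝔫)`-invariant `φ ∈ W` all of whose `K_∞`-slices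
`k ↦ φ(g k)` lie in `M` lie in the span of the automorphic forms of level `K(𝔫)`, that character and
slices in `M` — finite-dimensional by the tree's PROVED `harishChandra_finiteness_gl_holds`.
[cite: BorelJacquetCorvallis1979, 4.3 (i) and 4.6] [cite: HarishChandra1968, Thm. 1] -/
theorem stub_finiteDimensional_levelKSlice {n : ℕ} {K : Type} [Field K] [NumberField K]
    (hcpt : isCompact_glFiniteIntegralLevel n K) (𝔫 : Ideal (𝓞 K)) (h𝔫 : 𝔫 ≠ 0)
    (π : CuspidalAutomorphicRepData n K hcpt) (hbot : π.1.W' = ⊥)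
    (M : Submodule ℂ (Kinf n K → ℂ)) [FiniteDimensional ℂ M]
    (hM : ∀ k₀ : Kinf n K, ∀ f ∈ M, (fun k => f (k * k₀)) ∈ M) :
    ∃ T : Submodule ℂ ((AdelicGroupData.gl n K).Adelic → ℂ), FiniteDimensional ℂ T ∧
      ∀ φ ∈ π.1.W,
        (∀ u ∈ principalCongruenceLevel n K 𝔫, rightTranslation (AdelicGroupData.gl n K) u φ = φ) →
          (∀ g : (AdelicGroupData.gl n K).Adelic,
            (fun k : Kinf n K => φ (g * (AutomorphyDatum.gl n K hcpt).ofK k)) ∈ M) →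
            φ ∈ T := by
  -- the infinitesimal character of the irreducible `W / W'` (Schur), a character on all of `W`
  obtain ⟨θ, hθ⟩ := π.1.exists_hasInfinitesimalCharacter_gl
  -- `K(𝔫)` is an admissible level
  have hU : principalCongruenceLevel n K 𝔫 ∈ finiteLevelsGL n K :=
    principalCongruenceLevel_mem_finiteLevelsGL_holds n K h𝔫
  refine ⟨Submodule.span ℂ
      {φ : (AdelicGroupData.gl n K).Adelic → ℂ | IsAutomorphicForm (AutomorphyDatum.gl n K hcpt) φ ∧
        IsRightInvariantUnder (principalCongruenceLevel n K 𝔫) φ ∧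
          HasZCharacter (AutomorphyDatum.gl n K hcpt).ofArch φ θ ∧
            ∀ g : (AdelicGroupData.gl n K).Adelic,
              (fun k : Kinf n K => φ (g * (AutomorphyDatum.gl n K hcpt).ofK k)) ∈ M},
    harishChandra_finiteness_gl_holds hcpt hU θ M hM, ?_⟩
  intro φ hφ hinv hslice
  refine Submodule.subset_span ⟨?_, fun u hu g => congrFun (hinv u hu) g,
    hasZCharacter_of_hasInfinitesimalCharacter_of_bot π.1 hbot hθ hφ, hslice⟩
  exact isAutomorphicForm_of_mem_automorphicForms_gl
    (cuspFormsGL_le_automorphicForms n K hcpt (π.2 hφ))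

end Summit.Langlands.Langlands.Theorems.HeckeEigenvalueField.Res

end
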